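import Literature.AlgebraicGeometry.Motives.GoodReduction
import Literature.NumberTheory.EllipticCurves.NeronModel
import Mathlib.CategoryTheory.Monoidal.Cartesian.Over
import HarnessLib

/-!
# The product of two integral models is an integral model of the product ([SerreTate1968] §1; [GortzWedhorn2020] (4.7))

Topic `Literature/AlgebraicGeometry/Motives`, namespace `Literature.AlgebraicGeometry.Motives.IntegralModel`.  One choice-free DEFINITION +
theorems; NO named fact, no instance, no notation, no `sorry`.  Cell `hodgecm-mathlib` (D-0151), FLOOR 0, programme F0P5a (D9op road 2′, crux
item stmt-HodgeConjecture-24832): piece C2a′ of the C2 package (planner ED4-CUT-LETTER v0 §1): the ED4 composition reduces geometric points of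
`𝒮 ⊗ 𝒮` (`𝒮` the smooth proper model of the record curve) and reads them as pairs; this file packages `𝒮 ⊗ 𝒮` as an `IntegralModel` of
`X ⊗ X` so that ★ `IntegralModel.geomReductionMap` / `geomReductionMap_map` (p793383) apply to it and to its two projections verbatim.

* `IntegralModel.tensor 𝒳 𝒴 : IntegralModel R K (X ⊗ Y)` — total space `𝒳.total ⊗ 𝒴.total`, generic isomorphism
  `(𝒳 ⊗ 𝒴)_K ≅[μ⁻¹] 𝒳_K ⊗ 𝒴_K ≅[e_𝒳 ⊗ e_𝒴] X ⊗ Y` through the tensorator `μ` of the cartesian-monoidal base-change functor `genericFibre R K = baseChange R K`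
  (`Over.pullback`, by `rfl`; Mathlib `Functor.Monoidal (Over.pullback _)`); `tensor_total`, `μ_comp_tensor_genericIso_hom`;
* `map_fst_comp_genericIso_hom`, `map_snd_comp_genericIso_hom` — the projections `fst : 𝒳 ⊗ 𝒴 ⟶ 𝒳`, `snd` have generic fibres `fst`, `snd` in the shape
  `(genericFibre R K).map 𝔣 ≫ e_𝒴 = e_{𝒳⊗𝒴} ≫ f` consumed by ★ `geomReductionMap_map` (C2a′: the reduction of a pair is the pair of reductions);
* `IsSmoothProper.tensor` — `𝒳 ⊗ 𝒴` is smooth of relative dimension `e + d` and proper when `𝒳`, `𝒴` are smooth proper of relative dimensions `d`, `e`.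

HC_CM is proved only modulo the 7 printed citations until rung 0 closes; this file is a generic leaf and changes no count.

## References
* [SerreTate1968] J.-P. Serre, J. Tate, *Good reduction of abelian varieties*, Ann. of Math. 88 (1968), §1.
* [GortzWedhorn2020] U. Görtz, T. Wedhorn, *Algebraic Geometry I*, 2nd ed. (2020), Section (4.7) (fibre products and base change), Prop. 4.32.
-/

set_option autoImplicit false

noncomputable section

open CategoryTheory CategoryTheory.Limits AlgebraicGeometry MonoidalCategory
open Literature.NumberTheory.EllipticCurves (genericFibre)

namespace Literature.AlgebraicGeometry.Motives

namespace IntegralModel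

universe u

variable {R K : Type u} [CommRing R] [Field K] [Algebra R K] {X Y : SchemeOver K}

/-- **The product model**: for integral models `𝒳` of `X` and `𝒴` of `Y` over `R`, the `R`-scheme `𝒳 ⊗ 𝒴 = 𝒳 ×_R 𝒴` is an integral model of
`X ⊗ Y = X ×_K Y`, with generic isomorphism `(𝒳 ⊗ 𝒴)_K ≅ 𝒳_K ⊗ 𝒴_K ≅ X ⊗ Y` (base change commutes with fibre products, [GortzWedhorn2020] (4.7);
Mathlib: `Over.pullback` is cartesian-monoidal, tensorator `Functor.Monoidal.μIso`). [cite: GortzWedhorn2020, Section (4.7)] [cite: SerreTate1968, §1] -/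
def tensor (𝒳 : IntegralModel R K X) (𝒴 : IntegralModel R K Y) : IntegralModel R K (X ⊗ Y) where
  total := 𝒳.total ⊗ 𝒴.total
  genericIso := (Functor.Monoidal.μIso (genericFibre R K) 𝒳.total 𝒴.total).symm ≪≫ (𝒳.genericIso ⊗ᵢ 𝒴.genericIso)

/-- The total space of the product model is the fibre product of the total spaces (by construction). [cite: GortzWedhorn2020, Section (4.7)] -/
@[simp] theorem tensor_total (𝒳 : IntegralModel R K X) (𝒴 : IntegralModel R K Y) : (𝒳.tensor 𝒴).total = 𝒳.total ⊗ 𝒴.total := rfl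

/-- The generic isomorphism of the product model, through the tensorator: `μ ≫ e_{𝒳⊗𝒴} = e_𝒳 ⊗ e_𝒴`. [cite: GortzWedhorn2020, Section (4.7)] -/
theorem μ_comp_tensor_genericIso_hom (𝒳 : IntegralModel R K X) (𝒴 : IntegralModel R K Y) :
    Functor.LaxMonoidal.μ (genericFibre R K) 𝒳.total 𝒴.total ≫ (𝒳.tensor 𝒴).genericIso.hom = 𝒳.genericIso.hom ⊗ₘ 𝒴.genericIso.hom := by
  change Functor.LaxMonoidal.μ (genericFibre R K) 𝒳.total 𝒴.total ≫
    (Functor.Monoidal.μIso (genericFibre R K) 𝒳.total 𝒴.total).inv ≫ (𝒳.genericIso.hom ⊗ₘ 𝒴.genericIso.hom) = _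
  rw [← Functor.Monoidal.μIso_hom, Iso.hom_inv_id_assoc]
  rfl

/-- **The first projection of the product model has generic fibre `fst`**: `(fst)_K ≫ e_𝒳 = e_{𝒳⊗𝒴} ≫ fst` — the hypothesis shape of ★
`IntegralModel.geomReductionMap_map` (so the reduction of a pair projects to the reduction of its first component). [cite: GortzWedhorn2020, Section (4.7)] -/
theorem map_fst_comp_genericIso_hom (𝒳 : IntegralModel R K X) (𝒴 : IntegralModel R K Y) :
    (genericFibre R K).map (CartesianMonoidalCategory.fst 𝒳.total 𝒴.total) ≫ 𝒳.genericIso.hom =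
      (𝒳.tensor 𝒴).genericIso.hom ≫ CartesianMonoidalCategory.fst X Y := by
  change _ = ((Functor.Monoidal.μIso (genericFibre R K) 𝒳.total 𝒴.total).inv ≫ (𝒳.genericIso.hom ⊗ₘ 𝒴.genericIso.hom)) ≫ _
  rw [Category.assoc, CartesianMonoidalCategory.tensorHom_fst, ← Category.assoc, Functor.Monoidal.μIso_inv,
    Functor.OplaxMonoidal.δ_fst]

/-- **The second projection of the product model has generic fibre `snd`**: `(snd)_K ≫ e_𝒴 = e_{𝒳⊗𝒴} ≫ snd`. [cite: GortzWedhorn2020, Section (4.7)] -/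
theorem map_snd_comp_genericIso_hom (𝒳 : IntegralModel R K X) (𝒴 : IntegralModel R K Y) :
    (genericFibre R K).map (CartesianMonoidalCategory.snd 𝒳.total 𝒴.total) ≫ 𝒴.genericIso.hom =
      (𝒳.tensor 𝒴).genericIso.hom ≫ CartesianMonoidalCategory.snd X Y := by
  change _ = ((Functor.Monoidal.μIso (genericFibre R K) 𝒳.total 𝒴.total).inv ≫ (𝒳.genericIso.hom ⊗ₘ 𝒴.genericIso.hom)) ≫ _
  rw [Category.assoc, CartesianMonoidalCategory.tensorHom_snd, ← Category.assoc, Functor.Monoidal.μIso_inv,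
    Functor.OplaxMonoidal.δ_snd]

/-- **The product of smooth proper models is smooth proper** (relative dimension `e + d`): `(𝒳 ⊗ 𝒴 → Spec R) = pr₁ ≫ (𝒳 → Spec R)` with `pr₁` a
base change of `𝒴 → Spec R` (smoothness of a relative dimension and properness are stable under base change and composition, [GortzWedhorn2020]
Prop. 4.32 / Remark 6.15 (3), 12.58). [cite: GortzWedhorn2020, Section (4.7) and Prop. 4.32] -/
theorem IsSmoothProper.tensor {𝒳 : IntegralModel R K X} {𝒴 : IntegralModel R K Y} {d e : ℕ} (h𝒳 : 𝒳.IsSmoothProper d)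
    (h𝒴 : 𝒴.IsSmoothProper e) : (𝒳.tensor 𝒴).IsSmoothProper (e + d) := by
  haveI := h𝒳.1; haveI := h𝒳.2; haveI := h𝒴.1; haveI := h𝒴.2
  haveI := smoothOfRelativeDimension_isStableUnderBaseChange (n := e)
  haveI : SmoothOfRelativeDimension e (pullback.fst 𝒳.total.hom 𝒴.total.hom) := MorphismProperty.pullback_fst _ _ ‹_›
  haveI : IsProper (pullback.fst 𝒳.total.hom 𝒴.total.hom) := MorphismProperty.pullback_fst _ _ ‹_›
  refine ⟨?_, ?_⟩
  · change SmoothOfRelativeDimension (e + d) (𝒳.total ⊗ 𝒴.total).hom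
    rw [Over.tensorObj_hom]
    exact smoothOfRelativeDimension_comp e d (pullback.fst 𝒳.total.hom 𝒴.total.hom) 𝒳.total.hom
  · change IsProper (𝒳.total ⊗ 𝒴.total).hom
    rw [Over.tensorObj_hom]
    exact MorphismProperty.comp_mem _ _ _ ‹IsProper (pullback.fst 𝒳.total.hom 𝒴.total.hom)› h𝒳.2

end IntegralModel

end Literature.AlgebraicGeometry.Motives

end
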